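import Literature.AlgebraicGeometry.HodgeTheory.AbelianPencilInvariantCyclesCriteria
import Literature.AlgebraicGeometry.HodgeTheory.VanishingCohomologyNontrivialProofs
import Literature.AlgebraicGeometry.HodgeTheory.SupportedHodgeClassDescent
import Literature.AlgebraicGeometry.HodgeTheory.ComplexOrientationFamily
import Literature.AlgebraicTopology.SingularHomology.GysinMapSupportProofs
import Literature.AlgebraicGeometry.HodgeTheory.ComplexGysin
import Literature.AlgebraicGeometry.HodgeTheory.GysinBaseChangeOfKunneth
import Literature.AlgebraicGeometry.HodgeTheory.HyperplaneSectionMonodromySmoothLocus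
import Literature.AlgebraicTopology.SingularHomology.PoincareDualityCorollaries
import Literature.AlgebraicGeometry.HodgeTheory.HolomorphicBundleChernCharacterTopDegree
import Mathlib.LinearAlgebra.Dual.Lemmas
import Mathlib.LinearAlgebra.PerfectPairing.Basic
import HarnessLib

/-!
# The Gysin map of a fibre of a compact abelian pencil and the numerical lift of fibrewise algebraicity

For a compact pencil `f : 𝒳 ⟶ S` of abelian `d`-folds and `t ∈ S(ℂ)`, `fiberGysin hf t p : H²ᵖ(𝒳_t(ℂ); ℂ) → H^{2p+2}(𝒳(ℂ); ℂ)`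
is the Gysin morphism `j_{t*}` of the fibre inclusion (the tree's constructed `complexGysin` for the complex orientation
family). This file proves the "lift" step of Abdulali 1994 p. 1122 / Milne 2020 Prop. 1 in the tree's language:

* Part 1 — the DEFINITION `fiberGysin`, `fiberGysin_mem_algebraicClasses` (`j_{t*} N^p(𝒳_t) ⊆ N^{p+1}(𝒳)`), `fiberGysin_map_fiberι_eq_cupProduct`
  (projection formula `j_{t*} j_t^* W = W ∪ [𝒳_t]`).
* Part 2 — extreme degrees: `fiberGysin_one_ne_zero` (`[𝒳_t] ≠ 0`), `exists_fiberGysin_map_fiberι_top_ne_zero`,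
  `fiberGysin_top_injective` (`j_{t*}` is injective on `H^{2d}(𝒳_t)`).
* Part 3 — the numerical lift: `mem_of_forall_orthogonal_of_nondegenerate(')` (bi-orthogonality for a pairing non-degenerate on
  finite-dimensional subspaces), `fiberGysin_cupProduct_map_fiberι` / `cupProduct_map_fiberι_eq_zero_iff` (transpose identities
  `j_t^* a ∪ b = 0 ⟺ a ∪ j_{t*} b = 0`), `comap_le_sup_of_biorthogonal_of_numerical`, `comap_le_sup_of_nondegenerate_of_numerical`,
  `comap_eq_sup_of_nondegenerate_of_numerical` (`(j_t^*)⁻¹ N^p(𝒳_t) = N^p(𝒳) + ker j_t^*` under fibrewise non-degeneracy (Perf_t)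
  and (Num_t)), and `invariantCyclesHoldFor_of_nondegenerate_of_numerical` (Abdulali's (1.1) for the pencil from (Perf) and (Num)
  at every point).

One definition (`fiberGysin`, with body), theorems otherwise; no named fact; nothing here asserts a case of the Hodge conjecture.

## References

* [Abdulali1994FamiliesAV] S. Abdulali, Algebraic cycles in families of abelian varieties, Canad. J. Math. 46 (1994), (1.1) and p. 1122.
* [Milne2020HodgeClassesAV] J. S. Milne, Hodge classes on abelian varieties (2020), Prop. 1 (p. 7).
* [Kleiman1968AlgebraicCycles] S. Kleiman, Algebraic cycles and the Weil conjectures (1968), §3 (D(X)).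
* [FultonYoungTableaux1997] W. Fulton, Young Tableaux, Appendix B §B.1 (5)–(6).
* [Fulton1998] W. Fulton, Intersection Theory, §1.4, §16.1, §19.1–19.2.
* [VoisinHodgeI2002] C. Voisin, Hodge Theory and Complex Algebraic Geometry I, §7.3.2.
* [VoisinHodgeII2003] C. Voisin, Hodge Theory and Complex Algebraic Geometry II, §9.2.4 Prop. 9.20–9.21, (10.7).
* [Voisin2025] C. Voisin, cycle classes (2025), §4.1 Example 4.2.
* [HatcherAT2002] A. Hatcher, Algebraic Topology, §3.3 Thm. 3.26, Prop. 3.38.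
* [GriffithsHarrisPrinciples1978] P. Griffiths, J. Harris, Principles of Algebraic Geometry, Ch. 0 §7.

Provenance: Literature home (namespace `Literature.AlgebraicGeometry.HodgeTheory.AbelianPencil`) of the used declarations of the
Summits-side `HodgeConjecture/Theorems/Ring2AbelianAllAndre{FibreClass (3/27), FibreClassExtremeDegrees (3/16), NumericalLift (8/13)}`
(namespace `…Ring2.AbelianAll`; imports `Literature/` and Mathlib only), re-homed verbatim towards the Literature-side discharge of
`Abdulali1994.Abdulali1994_invariantCycles_of_lefschetzStandard{,A}`. Layer 3/4 (imports layer 1, `AbelianPencilInvariantCyclesCriteria`; layer 2 is `StandardConjectureANondegeneratePairing`).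
-/

noncomputable section

namespace Literature.AlgebraicGeometry.HodgeTheory.AbelianPencil

/-! ## Part 1: The Gysin map `j_{t*}` of a fibre: algebraic classes, projection formula -/

section Part1

open _root_.CategoryTheory _root_.AlgebraicGeometry MonoidalCategory
open Literature.AlgebraicGeometry Literature.AlgebraicGeometry.Motives
open Literature.AlgebraicGeometry.HodgeTheory
open Literature.AlgebraicTopology.SingularHomology (singularCohomology cupProduct cupProduct_one gysinMap_restrictCompl_eq_zero_of_field)

variable {𝒳 S : SchemeOver ℂ}

/-! ## §0 Toolkit: correspondences and Gysin maps preserve algebraic classes; the Hodge lift -/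

/-- **The Gysin morphism `j_{t*} : H²ᵖ(𝒳_t(ℂ); ℂ) → H^{2p+2}(𝒳(ℂ); ℂ)` of the inclusion `j_t : 𝒳_t ↪ 𝒳` of
the fibre at `t` of a compact pencil of abelian varieties of relative dimension `d`** (the fibre is a smooth
projective `d`-fold, the total space a smooth projective `(d+1)`-fold): the tree's CONSTRUCTED Gysin morphism
`complexGysin` (`D_𝒳⁻¹ ∘ j_t(ℂ)_* ∘ D_{𝒳_t}`) for the complex orientation family `complexOrientationFamily`.
By the projection formula `j_{t*}(j_t^* W) = W ∪ j_{t*} 1 = W ∪ [𝒳_t]` — cup product with the FIBRE CLASS.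
[cite: FultonYoungTableaux1997, Appendix B §B.1 (5)–(6)] [cite: VoisinHodgeI2002, §7.3.2] -/
def fiberGysin {d : ℕ} {f : 𝒳 ⟶ S} (hf : IsCompactAbelianPencil f d) (t : ComplexPoints S) (p : ℕ) :
    complexBetti (fiberOver f t) (2 * p) →ₗ[ℂ] complexBetti 𝒳 (2 * (p + 1)) :=
  complexGysin complexOrientationFamily (hf.isSmoothProjective_fiberOver t) hf.isSmoothProjective_total
    (fiberι f t) (by omega)

/-- **`j_{t*}` maps algebraic classes of the fibre to algebraic classes of the total space** (push-forward
of cycles along the closed immersion `𝒳_t ↪ 𝒳`: `Nᵖ H²ᵖ(𝒳_t) → N^{p+1} H^{2p+2}(𝒳)`), by the tree's theorem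
`complexGysin_mem_algebraicClasses` (support property of Gysin maps, `gysinMap_restrictCompl_eq_zero_of_field ℂ`,
and Poincaré duality for the complex orientations, `hasPoincareDuality_complexOrientationFamily`).
[cite: Voisin2025, §4.1 Example 4.2 (p. 38)] [cite: Fulton1998, §19.1 and §1.4] -/
theorem fiberGysin_mem_algebraicClasses {d : ℕ} {f : 𝒳 ⟶ S} (hf : IsCompactAbelianPencil f d)
    (t : ComplexPoints S) {p : ℕ} {z : complexBetti (fiberOver f t) (2 * p)}
    (hz : z ∈ algebraicClasses (fiberOver f t) p) : fiberGysin hf t p z ∈ algebraicClasses 𝒳 (p + 1) :=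
  complexGysin_mem_algebraicClasses (gysinMap_restrictCompl_eq_zero_of_field ℂ) complexOrientationFamily
    hasPoincareDuality_complexOrientationFamily (hf.isSmoothProjective_fiberOver t) hf.isSmoothProjective_total
    (fiberι f t) (by omega) _ hz

/-- **`j_{t*} j_t^* W = W ∪ [𝒳_t]`: the operator inverted by β-Lefschetz IS cup product with the fibre class**
`[𝒳_t] := j_{t*} 1 ∈ H²(𝒳(ℂ); ℂ)` (projection formula `f_*(f^* x ∪ y) = x ∪ f_* y` with `y = 1`, the tree's
`complexGysin_cup`, and `a ∪ 1 = a`). Faithfulness of the name of the node; not used by the edges below.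
[cite: FultonYoungTableaux1997, Appendix B §B.1 (6)] [cite: VoisinHodgeI2002, §7.3.2] -/
theorem fiberGysin_map_fiberι_eq_cupProduct {d : ℕ} {f : 𝒳 ⟶ S} (hf : IsCompactAbelianPencil f d)
    (t : ComplexPoints S) {p : ℕ} (W : complexBetti 𝒳 (2 * p)) :
    fiberGysin hf t p (complexBetti.map (fiberι f t) (2 * p) W) =
      cupProduct (show 2 * p + 2 * (0 + 1) = 2 * (p + 1) by ring) W
        (fiberGysin hf t 0 (singularCohomology.one ℂ (ComplexPoints (fiberOver f t)))) := by
  have h := complexGysin_cup (μ := complexOrientationFamily) hasPoincareDuality_complexOrientationFamily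
    (hf.isSmoothProjective_fiberOver t) hf.isSmoothProjective_total (fiberι f t) (Nat.add_zero (2 * p))
    (show 2 * p + 2 * (d + 1) = 2 * (p + 1) + 2 * d by ring)
    (show 2 * 0 + 2 * (d + 1) = 2 * (0 + 1) + 2 * d by ring)
    (show 2 * p + 2 * (0 + 1) = 2 * (p + 1) by ring) W (singularCohomology.one ℂ (ComplexPoints (fiberOver f t)))
  rw [cupProduct_one] at h
  exact h

end Part1

/-! ## Part 2: The fibre class is non-zero; `j_{t*}` is injective on the top degree of the fibre -/

section Part2

open _root_.CategoryTheory _root_.AlgebraicGeometry MonoidalCategory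
open Literature.AlgebraicGeometry Literature.AlgebraicGeometry.Motives
open Literature.AlgebraicGeometry.HodgeTheory
open Literature.AlgebraicTopology.SingularHomology (singularCohomology cupPairing isPerfPair_cupPairing_of_field_holds)

variable {𝒳 S : SchemeOver ℂ}

/-! ## §1 The fibre class is non-zero -/

/-- **`[𝒳_t] = j_{t*} 1 ≠ 0` in `H²(𝒳(ℂ); ℂ)`** for every fibre of a compact pencil of abelian varieties:
`j_t : 𝒳_t ⟶ 𝒳` is a closed immersion (base change of the closed point `t` of the separated `S`), the fibre
`𝒳_t(ℂ)` is non-empty (connected, SGA1 XII 2.4), and a closed immersion of smooth projective varieties pushes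
`1` forward to a non-zero class (Wirtinger; the tree's `complexGysin_one_ne_zero_of_stalkMap_surjective`).
[cite: GriffithsHarrisPrinciples1978, Ch. 0 §7 pp. 109–111] [cite: FultonYoungTableaux1997, Appendix B §B.1 (5)] -/
theorem fiberGysin_one_ne_zero {d : ℕ} {f : 𝒳 ⟶ S} (hf : IsCompactAbelianPencil f d) (t : ComplexPoints S) :
    fiberGysin hf t 0 (singularCohomology.one ℂ (ComplexPoints (fiberOver f t))) ≠ 0 := by
  haveI : IsProper S.hom := IsSmoothProjective.isProper_holds hf.isSmoothProjective_base
  haveI : IsClosedImmersion (fiberι f t).left := isClosedImmersion_fiberι_left f t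
  haveI := connectedSpace_complexPoints (hf.isSmoothProjective_fiberOver t)
  obtain ⟨P⟩ : Nonempty (ComplexPoints (fiberOver f t)) := inferInstance
  exact complexGysin_one_ne_zero_of_stalkMap_surjective complexOrientationFamily hf.isSmoothProjective_total
    (hf.isSmoothProjective_fiberOver t) (fiberι f t) P ((fiberι f t).left.stalkMap_surjective P.pt)
    (e := 1) (by omega)

/-! ## §2 Degree `0`: `H⁰(𝒳(ℂ); ℂ) = ℂ · 1` -/

/-- **Some `x ∈ H^{2d}(𝒳(ℂ); ℂ)` has `x ∪ [𝒳_t] = j_{t*} j_t^* x ≠ 0`**: the cup pairing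
`H^{2d} × H² → H^{2d+2} → ℂ` of the closed oriented `(2d+2)`-manifold `𝒳(ℂ)` is perfect over the field `ℂ`
(Hatcher Prop. 3.38, the tree's `isPerfPair_cupPairing_of_field_holds`), and `[𝒳_t] ≠ 0` (§1); the identity
`j_{t*} j_t^* x = x ∪ j_{t*} 1` is part V's projection formula. [cite: HatcherAT2002, §3.3 Prop. 3.38]
[cite: FultonYoungTableaux1997, Appendix B §B.1 (6)] -/
theorem exists_fiberGysin_map_fiberι_top_ne_zero {d : ℕ} {f : 𝒳 ⟶ S} (hf : IsCompactAbelianPencil f d)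
    (t : ComplexPoints S) :
    ∃ x : complexBetti 𝒳 (2 * d), fiberGysin hf t d (complexBetti.map (fiberι f t) (2 * d) x) ≠ 0 := by
  have h𝒳 := hf.isSmoothProjective_total
  by_contra hall
  push Not at hall
  apply fiberGysin_one_ne_zero hf t
  letI := h𝒳.chartedSpace
  haveI := Motives.ComplexPoints.compactSpace_of_isSmoothProjective h𝒳
  haveI := Motives.ComplexPoints.t2Space_of_isSmoothProjective h𝒳
  have hdeg : 2 * d + 2 * (0 + 1) = 2 * (d + 1) := by ring
  have hP : (cupPairing (complexOrientationFamily h𝒳) hdeg).IsPerfPair := isPerfPair_cupPairing_of_field_holds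
  refine (LinearMap.IsPerfPair.bijective_right (cupPairing (complexOrientationFamily h𝒳) hdeg)).1 ?_
  rw [map_zero]
  ext x
  rw [LinearMap.flip_apply, LinearMap.zero_apply,
    Literature.AlgebraicTopology.SingularHomology.cupPairing_apply, ← fiberGysin_map_fiberι_eq_cupProduct hf t x,
    hall x, map_zero, LinearMap.zero_apply]

/-- **`j_{t*}` is injective on the top degree `H^{2d}(𝒳_t(ℂ); ℂ)` of every fibre**: that space is the line
through `j_t^* x` for the `x` of `exists_fiberGysin_map_fiberι_top_ne_zero` (`exists_eq_smul_of_top`), and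
`j_{t*}(c · j_t^* x) = c · j_{t*} j_t^* x` vanishes only for `c = 0`. [cite: HatcherAT2002, §3.3 Thm. 3.26 and Prop. 3.38] -/
theorem fiberGysin_top_injective {d : ℕ} {f : 𝒳 ⟶ S} (hf : IsCompactAbelianPencil f d) (t : ComplexPoints S)
    {a : complexBetti (fiberOver f t) (2 * d)} (ha : fiberGysin hf t d a = 0) : a = 0 := by
  obtain ⟨x, hx⟩ := exists_fiberGysin_map_fiberι_top_ne_zero hf t
  have hx0 : complexBetti.map (fiberι f t) (2 * d) x ≠ 0 := by
    intro h0
    exact hx (by rw [h0, map_zero])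
  obtain ⟨c, rfl⟩ := exists_eq_smul_of_top complexOrientationFamily (hf.isSmoothProjective_fiberOver t) hx0 a
  rw [map_smul] at ha
  rcases smul_eq_zero.1 ha with hc | h
  · rw [hc, zero_smul]
  · exact (hx h).elim

end Part2

/-! ## Part 3: The numerical lift: `(j_t^*)⁻¹ N^p(𝒳_t) = N^p(𝒳) + ker j_t^*` under (Perf_t) and (Num_t) -/

section Part3

open _root_.CategoryTheory _root_.AlgebraicGeometry
open Literature.AlgebraicGeometry Literature.AlgebraicGeometry.Motives
open Literature.AlgebraicGeometry.HodgeTheory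
open Literature.AlgebraicTopology.SingularHomology (cupProduct)
open Literature.AlgebraicGeometry.Abdulali1994 (InvariantCyclesHoldFor)

/-! ## §1 Linear algebra: bi-orthogonality inside a subspace for a pairing non-degenerate on it -/

section LinAlg

variable {K : Type*} [Field K] {M N L : Type*} [AddCommGroup M] [Module K M] [AddCommGroup N] [Module K N]
  [AddCommGroup L] [Module K L]

/-- **Bi-orthogonality for a non-degenerate pairing of finite-dimensional subspaces.** Let `B : M × N → K` be
bilinear and `A ≤ M`, `A' ≤ N` finite-dimensional with `B` non-degenerate on `A × A'` on both sides. Then every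
subspace `V ≤ A` is cut out inside `A` by `A'`: if `ξ ∈ A` satisfies `B(ξ, b) = 0` for every `b ∈ A'` orthogonal to `V`,
then `ξ ∈ V` (`A ≃ (A')^*` by the pairing, and `W^{⊥⊥} = W` for subspaces `W` of a finite-dimensional dual).
 [cite: Abdulali1994FamiliesAV, (1.1) p. 1122] -/
theorem mem_of_forall_orthogonal_of_nondegenerate (B : M →ₗ[K] N →ₗ[K] K) {A : Submodule K M}
    {A' : Submodule K N} [FiniteDimensional K A] [FiniteDimensional K A']
    (h₁ : ∀ a ∈ A, (∀ b ∈ A', B a b = 0) → a = 0) (h₂ : ∀ b ∈ A', (∀ a ∈ A, B a b = 0) → b = 0)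
    {V : Submodule K M} (hV : V ≤ A) {ξ : M} (hξ : ξ ∈ A)
    (h : ∀ b ∈ A', (∀ v ∈ V, B v b = 0) → B ξ b = 0) : ξ ∈ V := by
  set P : A →ₗ[K] A' →ₗ[K] K := B.domRestrict₁₂ A A' with hP
  have hinj : Function.Injective P := by
    intro a₁ a₂ ha
    rw [← sub_eq_zero]
    have h0 : P (a₁ - a₂) = 0 := by rw [map_sub, ha, sub_self]
    refine Subtype.ext ?_
    rw [Submodule.coe_sub, Submodule.coe_zero]
    refine h₁ _ (A.sub_mem a₁.2 a₂.2) fun b hb ↦ ?_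
    have := LinearMap.congr_fun h0 ⟨b, hb⟩
    simpa [hP, LinearMap.domRestrict₁₂_apply] using this
  have hinj' : Function.Injective P.flip := by
    intro b₁ b₂ hb
    rw [← sub_eq_zero]
    have h0 : P.flip (b₁ - b₂) = 0 := by rw [map_sub, hb, sub_self]
    refine Subtype.ext ?_
    rw [Submodule.coe_sub, Submodule.coe_zero]
    refine h₂ _ (A'.sub_mem b₁.2 b₂.2) fun a ha ↦ ?_
    have := LinearMap.congr_fun h0 ⟨a, ha⟩
    simpa [hP, LinearMap.domRestrict₁₂_apply] using this
  haveI : P.IsPerfPair := LinearMap.IsPerfPair.of_injective hinj hinj'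
  set e := P.toPerfPair with he
  set VA : Submodule K A := V.comap A.subtype with hVA
  set W : Submodule K (Module.Dual K A') := VA.map e.toLinearMap with hW
  have hmem : e ⟨ξ, hξ⟩ ∈ W.dualCoannihilator.dualAnnihilator := by
    rw [Submodule.mem_dualAnnihilator]
    intro b' hb'
    rw [Submodule.mem_dualCoannihilator] at hb'
    have hb'V : ∀ v ∈ V, B v b' = 0 := by
      intro v hv
      have hv' : (⟨v, hV hv⟩ : A) ∈ VA := by simpa [hVA] using hv
      have := hb' (e ⟨v, hV hv⟩) (Submodule.mem_map_of_mem hv')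
      simpa [he, hP, LinearMap.domRestrict₁₂_apply] using this
    have := h b' b'.2 hb'V
    simpa [he, hP, LinearMap.domRestrict₁₂_apply] using this
  rw [Subspace.dualCoannihilator_dualAnnihilator_eq] at hmem
  obtain ⟨v, hv, hve⟩ := Submodule.mem_map.1 hmem
  have hvξ : v = ⟨ξ, hξ⟩ := e.injective hve
  rw [hVA, Submodule.mem_comap] at hv
  rw [hvξ] at hv
  exact hv

/-- The same for a pairing with values in a LINE `L` (`dim_K L = 1`), e.g. the cup product into the top cohomology of
a connected closed manifold. [cite: Abdulali1994FamiliesAV, (1.1) p. 1122] -/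
theorem mem_of_forall_orthogonal_of_nondegenerate' (B : M →ₗ[K] N →ₗ[K] L) (hL : Module.finrank K L = 1)
    {A : Submodule K M} {A' : Submodule K N} [FiniteDimensional K A] [FiniteDimensional K A']
    (h₁ : ∀ a ∈ A, (∀ b ∈ A', B a b = 0) → a = 0) (h₂ : ∀ b ∈ A', (∀ a ∈ A, B a b = 0) → b = 0)
    {V : Submodule K M} (hV : V ≤ A) {ξ : M} (hξ : ξ ∈ A)
    (h : ∀ b ∈ A', (∀ v ∈ V, B v b = 0) → B ξ b = 0) : ξ ∈ V := by
  haveI : FiniteDimensional K L := Module.finite_of_finrank_eq_succ hL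
  let ℓ : L ≃ₗ[K] K := LinearEquiv.ofFinrankEq L K (by rw [hL, Module.finrank_self])
  have hz : ∀ (m : M) (n : N), B.compr₂ ℓ.toLinearMap m n = 0 ↔ B m n = 0 := fun m n ↦ by
    rw [LinearMap.compr₂_apply]
    exact ℓ.map_eq_zero_iff
  refine mem_of_forall_orthogonal_of_nondegenerate (B.compr₂ ℓ.toLinearMap)
    (fun a ha hab ↦ h₁ a ha fun b hb ↦ (hz a b).1 (hab b hb))
    (fun b hb hab ↦ h₂ b hb fun a ha ↦ (hz a b).1 (hab a ha)) hV hξ fun b hb hbV ↦ ?_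
  exact (hz ξ b).2 (h b hb fun v hv ↦ (hz v b).1 (hbV v hv))

end LinAlg

variable {𝒳 S : SchemeOver ℂ}

/-! ## §2 Transpose identities: `j^* a ∪ b = 0 ⟺ a ∪ j_* b = 0`; `j_* b = 0 ⟺ b ⊥ Im j^*` -/

/-- **`j_{t*}(j_t^* a ∪ b) = a ∪ j_{t*} b`** (projection formula, the tree's `complexGysin_cup`) for `a ∈ H²ᵖ(𝒳)`,
`b ∈ H^{2q}(𝒳_t)`, `p + q = d`, on a compact pencil of abelian `d`-folds. [cite: FultonYoungTableaux1997, Appendix B §B.1 (6)] -/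
theorem fiberGysin_cupProduct_map_fiberι {d : ℕ} {f : 𝒳 ⟶ S} (hf : IsCompactAbelianPencil f d) (t : ComplexPoints S)
    {p q : ℕ} (hpq : p + q = d) (a : complexBetti 𝒳 (2 * p)) (b : complexBetti (fiberOver f t) (2 * q)) :
    fiberGysin hf t d (cupProduct (show 2 * p + 2 * q = 2 * d by omega) (complexBetti.map (fiberι f t) (2 * p) a) b) =
      cupProduct (show 2 * p + 2 * (q + 1) = 2 * (d + 1) by omega) a (fiberGysin hf t q b) := by
  have h := complexGysin_cup (μ := complexOrientationFamily) hasPoincareDuality_complexOrientationFamily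
    (hf.isSmoothProjective_fiberOver t) hf.isSmoothProjective_total (fiberι f t)
    (show 2 * p + 2 * q = 2 * d by omega)
    (show 2 * d + 2 * (d + 1) = 2 * (d + 1) + 2 * d by ring)
    (show 2 * q + 2 * (d + 1) = 2 * (q + 1) + 2 * d by omega)
    (show 2 * p + 2 * (q + 1) = 2 * (d + 1) by omega) a b
  exact h

/-- **`j_t^* a ∪ b = 0 ⟺ a ∪ j_{t*} b = 0`** (`p + q = d`): the projection formula and injectivity of `j_{t*}` on
`H^{2d}(𝒳_t(ℂ); ℂ)` (part XI). [cite: FultonYoungTableaux1997, Appendix B §B.1 (6)] [cite: HatcherAT2002, §3.3 Prop. 3.38] -/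
theorem cupProduct_map_fiberι_eq_zero_iff {d : ℕ} {f : 𝒳 ⟶ S} (hf : IsCompactAbelianPencil f d) (t : ComplexPoints S)
    {p q : ℕ} (hpq : p + q = d) (a : complexBetti 𝒳 (2 * p)) (b : complexBetti (fiberOver f t) (2 * q)) :
    cupProduct (show 2 * p + 2 * q = 2 * d by omega) (complexBetti.map (fiberι f t) (2 * p) a) b = 0 ↔
      cupProduct (show 2 * p + 2 * (q + 1) = 2 * (d + 1) by omega) a (fiberGysin hf t q b) = 0 := by
  rw [← fiberGysin_cupProduct_map_fiberι hf t hpq a b]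
  exact ⟨fun h ↦ by rw [h, map_zero], fun h ↦ fiberGysin_top_injective hf t h⟩

/-- **THE LIFT FROM BI-ORTHOGONALITY ON THE FIBRE AND "HOM ≡ NUM" FOR FIBRE-SUPPORTED CLASSES ON THE TOTAL SPACE.**
For a compact pencil of abelian `d`-folds, a point `t` and `p + q = d`: IF (Perf_t) every subspace `V ≤ N^p(𝒳_t)` is cut
out inside `N^p(𝒳_t)` by algebraic classes of degree `2q` (`ξ ∈ N^p(𝒳_t)` with `ξ ∪ b = 0` for all `b ∈ N^q(𝒳_t)`
orthogonal to `V` lies in `V`), AND (Num_t) every `b ∈ N^q(𝒳_t)` with `a ∪ j_{t*} b = 0` for all `a ∈ N^p(𝒳)` has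
`j_{t*} b = 0`, THEN `(j_t^*)⁻¹ N^p(𝒳_t) ≤ N^p(𝒳) + ker j_t^*` — every global class algebraic on `𝒳_t` is algebraic
on `𝒳` up to `ker j_t^*` (the lift (L) at `t`, part XVII-b's lattice form). [cite: Milne2020HodgeClassesAV, Prop. 1 (p. 7)]
[cite: Abdulali1994FamiliesAV, p. 1122] [cite: Kleiman1968AlgebraicCycles, §3 (D(X))] -/
theorem comap_le_sup_of_biorthogonal_of_numerical {d : ℕ} {f : 𝒳 ⟶ S} (hf : IsCompactAbelianPencil f d)
    (t : ComplexPoints S) {p q : ℕ} (hpq : p + q = d)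
    (hPerf : ∀ V : Submodule ℂ (complexBetti (fiberOver f t) (2 * p)), V ≤ algebraicClasses (fiberOver f t) p →
      ∀ ξ ∈ algebraicClasses (fiberOver f t) p,
        (∀ b ∈ algebraicClasses (fiberOver f t) q,
          (∀ v ∈ V, cupProduct (show 2 * p + 2 * q = 2 * d by omega) v b = 0) →
            cupProduct (show 2 * p + 2 * q = 2 * d by omega) ξ b = 0) → ξ ∈ V)
    (hNum : ∀ b ∈ algebraicClasses (fiberOver f t) q,
      (∀ a ∈ algebraicClasses 𝒳 p, cupProduct (show 2 * p + 2 * (q + 1) = 2 * (d + 1) by omega) a (fiberGysin hf t q b) = 0) →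
        fiberGysin hf t q b = 0) :
    (algebraicClasses (fiberOver f t) p).comap (complexBetti.map (fiberι f t) (2 * p)).hom ≤
      algebraicClasses 𝒳 p ⊔ LinearMap.ker (complexBetti.map (fiberι f t) (2 * p)).hom := by
  intro W hW
  have hW' : complexBetti.map (fiberι f t) (2 * p) W ∈ algebraicClasses (fiberOver f t) p := hW
  -- `V = j^* N^p(𝒳) ≤ N^p(𝒳_t)`
  set V : Submodule ℂ (complexBetti (fiberOver f t) (2 * p)) :=
    (algebraicClasses 𝒳 p).map (complexBetti.map (fiberι f t) (2 * p)).hom with hV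
  have hVle : V ≤ algebraicClasses (fiberOver f t) p := by
    rw [hV, Submodule.map_le_iff_le_comap]
    exact le_trans le_sup_left (algebraicClasses_sup_ker_le_comap hf p t)
  have hmem : complexBetti.map (fiberι f t) (2 * p) W ∈ V := by
    refine hPerf V hVle _ hW' fun b hb hbV ↦ ?_
    -- `b` kills `V`, so `a ∪ j_* b = 0` for all algebraic `a`, so `j_* b = 0`
    have hb0 : fiberGysin hf t q b = 0 := by
      refine hNum b hb fun a ha ↦ ?_
      rw [← cupProduct_map_fiberι_eq_zero_iff hf t hpq a b]
      exact hbV _ (Submodule.mem_map_of_mem ha)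
    rw [cupProduct_map_fiberι_eq_zero_iff hf t hpq, hb0, map_zero]
  obtain ⟨η, hη, hηW⟩ := Submodule.mem_map.1 hmem
  rw [show W = η + (W - η) by abel]
  refine Submodule.add_mem_sup hη ?_
  rw [LinearMap.mem_ker, map_sub, sub_eq_zero]
  exact hηW.symm

/-- **THE LIFT FROM TWO NON-DEGENERACIES.** Same conclusion with (Perf_t) replaced by its source: the cup pairing
`N^p(𝒳_t) × N^q(𝒳_t) → H^{2d}(𝒳_t(ℂ); ℂ) ≅ ℂ` is non-degenerate on both sides (homological ≡ numerical equivalence on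
the fibre in bidegree `(p, q)` — for an abelian fibre Lieberman's theorem in print; at a fibre satisfying the Hodge
conjecture, Hodge theory, part XVIII-b). [cite: Milne2020HodgeClassesAV, Prop. 1 (p. 7)] [cite: Lieberman1968, main theorem]
[cite: Kleiman1968AlgebraicCycles, §3 (D(X))] -/
theorem comap_le_sup_of_nondegenerate_of_numerical {d : ℕ} {f : 𝒳 ⟶ S} (hf : IsCompactAbelianPencil f d)
    (t : ComplexPoints S) {p q : ℕ} (hpq : p + q = d)
    (hND₁ : ∀ ξ ∈ algebraicClasses (fiberOver f t) p,
      (∀ b ∈ algebraicClasses (fiberOver f t) q, cupProduct (show 2 * p + 2 * q = 2 * d by omega) ξ b = 0) → ξ = 0)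
    (hND₂ : ∀ b ∈ algebraicClasses (fiberOver f t) q,
      (∀ ξ ∈ algebraicClasses (fiberOver f t) p, cupProduct (show 2 * p + 2 * q = 2 * d by omega) ξ b = 0) → b = 0)
    (hNum : ∀ b ∈ algebraicClasses (fiberOver f t) q,
      (∀ a ∈ algebraicClasses 𝒳 p, cupProduct (show 2 * p + 2 * (q + 1) = 2 * (d + 1) by omega) a (fiberGysin hf t q b) = 0) →
        fiberGysin hf t q b = 0) :
    (algebraicClasses (fiberOver f t) p).comap (complexBetti.map (fiberι f t) (2 * p)).hom ≤
      algebraicClasses 𝒳 p ⊔ LinearMap.ker (complexBetti.map (fiberι f t) (2 * p)).hom := by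
  have hXt := hf.isSmoothProjective_fiberOver t
  haveI := finite_complexBetti hXt (2 * p)
  haveI := finite_complexBetti hXt (2 * q)
  refine comap_le_sup_of_biorthogonal_of_numerical hf t hpq (fun V hV ξ hξ h ↦ ?_) hNum
  have hline : Module.finrank ℂ (complexBetti (fiberOver f t) (2 * d)) = 1 := finrank_complexBetti_two_mul_eq_one hXt
  exact mem_of_forall_orthogonal_of_nondegenerate' (cupProduct (show 2 * p + 2 * q = 2 * d by omega)) hline
    hND₁ hND₂ hV hξ h

/-- **Equality `C_t = R_t`** under (Perf_t) (two non-degeneracies) and (Num_t): the classes of the total space algebraic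
on `𝒳_t` are exactly `N^p(𝒳) + ker j_t^*` (`⊇` is unconditional, part XVII-b). [cite: Milne2020HodgeClassesAV, Prop. 1 (p. 7)] -/
theorem comap_eq_sup_of_nondegenerate_of_numerical {d : ℕ} {f : 𝒳 ⟶ S} (hf : IsCompactAbelianPencil f d)
    (t : ComplexPoints S) {p q : ℕ} (hpq : p + q = d)
    (hND₁ : ∀ ξ ∈ algebraicClasses (fiberOver f t) p,
      (∀ b ∈ algebraicClasses (fiberOver f t) q, cupProduct (show 2 * p + 2 * q = 2 * d by omega) ξ b = 0) → ξ = 0)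
    (hND₂ : ∀ b ∈ algebraicClasses (fiberOver f t) q,
      (∀ ξ ∈ algebraicClasses (fiberOver f t) p, cupProduct (show 2 * p + 2 * q = 2 * d by omega) ξ b = 0) → b = 0)
    (hNum : ∀ b ∈ algebraicClasses (fiberOver f t) q,
      (∀ a ∈ algebraicClasses 𝒳 p, cupProduct (show 2 * p + 2 * (q + 1) = 2 * (d + 1) by omega) a (fiberGysin hf t q b) = 0) →
        fiberGysin hf t q b = 0) :
    (algebraicClasses (fiberOver f t) p).comap (complexBetti.map (fiberι f t) (2 * p)).hom =
      algebraicClasses 𝒳 p ⊔ LinearMap.ker (complexBetti.map (fiberι f t) (2 * p)).hom :=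
  le_antisymm (comap_le_sup_of_nondegenerate_of_numerical hf t hpq hND₁ hND₂ hNum) (algebraicClasses_sup_ker_le_comap hf p t)

/-! ## §4 Consequences: (L∀)|_f and (1.1)_f from the hypotheses at every point; the node (L) and the cell row -/

/-- **(L∀)|_f and Abdulali's (1.1)_f from (Perf) and (Num) at EVERY point** of one compact pencil: then
`C_s = N^p(𝒳) + ker j_s^*` for every `s` and every `p ≤ d`, and — `ker j_s^*` being constant (part XVII-e) —
`s ↦ C_s` is constant: `InvariantCyclesHoldFor f d`. (Degrees `p > d` are vacuous: `H²ᵖ(𝒳_s) = 0`.)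
[cite: Abdulali1994FamiliesAV, (1.1) and p. 1122] [cite: Milne2020HodgeClassesAV, Prop. 1 (p. 7)] -/
theorem invariantCyclesHoldFor_of_nondegenerate_of_numerical {d : ℕ} {f : 𝒳 ⟶ S} (hf : IsCompactAbelianPencil f d)
    (h : ∀ (t : ComplexPoints S) (p q : ℕ) (hpq : p + q = d),
      (∀ ξ ∈ algebraicClasses (fiberOver f t) p,
        (∀ b ∈ algebraicClasses (fiberOver f t) q, cupProduct (show 2 * p + 2 * q = 2 * d by omega) ξ b = 0) → ξ = 0) ∧
      (∀ b ∈ algebraicClasses (fiberOver f t) q,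
        (∀ ξ ∈ algebraicClasses (fiberOver f t) p, cupProduct (show 2 * p + 2 * q = 2 * d by omega) ξ b = 0) → b = 0) ∧
      (∀ b ∈ algebraicClasses (fiberOver f t) q,
        (∀ a ∈ algebraicClasses 𝒳 p,
          cupProduct (show 2 * p + 2 * (q + 1) = 2 * (d + 1) by omega) a (fiberGysin hf t q b) = 0) →
          fiberGysin hf t q b = 0)) :
    InvariantCyclesHoldFor f d := by
  rw [invariantCyclesHoldFor_iff_comap_eq hf]
  intro p s s'
  rcases le_or_gt p d with hp | hp
  · obtain ⟨h₁, h₂, h₃⟩ := h s p (d - p) (by omega)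
    obtain ⟨h₁', h₂', h₃'⟩ := h s' p (d - p) (by omega)
    rw [comap_eq_sup_of_nondegenerate_of_numerical hf s (show p + (d - p) = d by omega) h₁ h₂ h₃,
      comap_eq_sup_of_nondegenerate_of_numerical hf s' (show p + (d - p) = d by omega) h₁' h₂' h₃',
      algebraicClasses_sup_ker_eq hf p s s']
  · haveI := subsingleton_complexBetti (hf.isSmoothProjective_fiberOver s) (show 2 * d < 2 * p by omega)
    haveI := subsingleton_complexBetti (hf.isSmoothProjective_fiberOver s') (show 2 * d < 2 * p by omega)
    ext W
    simp only [Submodule.mem_comap]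
    constructor <;> intro _ <;>
      · rw [Subsingleton.elim ((complexBetti.map (fiberι f _) (2 * p)).hom W) 0]; exact Submodule.zero_mem _

end Part3

end Literature.AlgebraicGeometry.HodgeTheory.AbelianPencil

end
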